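import Mathlib
import HarnessLib
import HarnessLib.Audit
import Summits.CriticalPhenomena.Statement
import Literature.Probability.Percolation.BoxCrossing
import Literature.Probability.Percolation.KestenScaling
import Literature.Probability.Percolation.ArmSeparationFourArm

/-!
Route: SeamPivotalNoGo

CLOSED (retired) 2026-08-15T13:48:10Z by operator:999:1257524 — reason: not-a-thesis: assembly does not conclude the sub-problem Statement — note: D-0027 §2.1 audit (human 2026-08-15: routes that do not decide the summit are removed): the assembly concludes `SeamSlideLaw`, not the sub-problem statement; a NEW conforming route may be opened from the same idea (generated `closes : … → _root_.CardyFormulaZ2`).. The file is kept as the record of this route; refuted decls are indexed as negative knowledge (`ledger negatives`).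

# Route SeamPivotalNoGo — Seam no-go (barrier route) — rigid box-wise similarity couplings scramble
percolation crossings; the 3/4-law for seam slides on the triangular lattice

BARRIER ROUTE (D-0021 negative knowledge), realising card seam-pivotal-mass-no-go. Declared up
front: X does NOT imply
CardyFormulaZ2 (nor its negation) and is not claimed to; like Theses/TaylorResolutionBarrier of
AnomalousDissipation it is a
no-go theorem for a TECHNIQUE CLASS, provable on the triangular lattice 𝕋 modulo two printed inputs,
whose landed Theorems file a
literature seat can vendor as Literature/Barriers/CriticalPhenomena/SeamPivotalMass. The class:
"symmetry upgrade by patchwork" —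
prove conformal covariance of the bond-ℤ² crossing limit by cutting the domain into boxes of scale
ε, transporting the
configuration of each box by a similarity approximating the conformal map φ (translations/rotations
are theorems,
DKKMO2020Rotational; scalings the putative missing symmetry) and re-gluing the pieces (legitimate
for a black noise,
SmirnovSchramm2011 Thm 1.7) — the mechanism of the retired card
coherent-gluing-similarity-to-conformal and of the "physicists'
road" quoted by DKKMO2020Rotational p. 3. Non-affinity of φ forces a seam mismatch ≍ |φ''|ε² on a
positive fraction of the seams
(support SimilarityDefect); in lattice units (box k = εn, slide s = ε²n = k²/n) the seams carry ≍
(n/k)(n/s)α₄(s,n) =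
(n/k)^{3-2ξ₄+o(1)} pivotal s-cells, which diverges iff ξ₄ < 3/2; on 𝕋, ξ₄ = 5/4
(SmirnovWernerMRL2001). X isolates the
mechanism in the cleanest MEASURE-PRESERVING model, the column slide on 𝕋: slide(x) = x if ⌊x₀/k⌋ is
even and x - (0,s)
otherwise; ω' = ω ∘ slide is again P_{1/2}; f_n = left-right open crossing of the rhombus R(n,n)
(`triLRCrossing n n`).
X = SeamSlideLaw ("3/4-law"; 3/4 = 2 - ξ₄): assuming the four-arm exponent 5/4 (`fourArm_exponent`,
hypothesis) and four-arm
separation (Nolin2008 Thm 11, hypothesis in the binder shape the tree already uses), for all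
sequences 1 ≤ s_n ≤ k_n ≤ n and
every θ > 0: if n^{3/4} s_n^{1/4} / k_n ≥ n^{θ} eventually then liminf P(f_n(ω) ≠ f_n(ω')) > 0
(SENSITIVE), and if
n^{3/4} s_n^{1/4} / k_n ≤ n^{-θ} eventually then P(f_n(ω) ≠ f_n(ω')) → 0 (INSENSITIVE). X = X_sens ∧
X_ins with X_sens =
SeamPivotalMass ∘ PivotalSeamForcesFlip and X_ins = SlideInsensitive. Recorded consequences:
ConformalRegimeSensitive (support; the
conformal regime s = ⌈k²/n⌉ is sensitive for EVERY box scale √n ≤ k ≤ n^{1-θ}: no rigid patchwork at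
vanishing box scale
transports crossings), and the insensitive side for boundedly many seams with sublinear slides (why
Schramm–Smirnov gluing along
fixed curves and curve/tip/exit-law upgrades — CardyRotToConf r2, card
kakutani-fingerprint-discrete-ito — are admissible: their
seams are 0/1-dimensional).
Lean: `Literature.Probability.Percolation.fourArm_exponent → (∃ c : ℝ, 0 < c ∧ ∃ n₀ : ℕ, ∀ n N : ℕ,
n₀ ≤ n → 2 * n ≤ N → c * Literature.Probability.Percolation.critFourArmProb n N ≤
(Literature.Probability.LatticeModels.triSitePercolation
Literature.Probability.Percolation.half).real (Literature.Probability.Percolation.sepFourArm n N)) →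
∀ θ : ℝ, 0 < θ → ∀ k s : ℕ → ℕ, (∀ n, 1 ≤ n → 1 ≤ s n ∧ s n ≤ k n ∧ k n ≤ n) → ((∀ᶠ n : ℕ in
Filter.atTop, (n : ℝ) ^ θ * (k n : ℝ) ≤ (n : ℝ) ^ (3 / 4 : ℝ) * (s n : ℝ) ^ (1 / 4 : ℝ)) → ∃ c : ℝ,
0 < c ∧ ∀ᶠ n : ℕ in Filter.atTop, c ≤ (Literature.Probability.LatticeModels.triSitePercolation
Literature.Probability.Percolation.half).real {ω | ¬ (ω ∈
Literature.Probability.Percolation.triLRCrossing n n ↔ (fun x :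
Literature.Probability.LatticeModels.Site 2 => if x 0 / (k n : ℤ) % 2 = 0 then x else x - ![0, (s n
: ℤ)]) ⁻¹' ω ∈ Literature.Probability.Percolation.triLRCrossing n n)}) ∧ ((∀ᶠ n : ℕ in Filter.atTop,
(n : ℝ) ^ (3 / 4 : ℝ) * (s n : ℝ) ^ (1 / 4 : ℝ) ≤ (n : ℝ) ^ (-θ) * (k n : ℝ)) → Filter.Tendsto (fun
n : ℕ => (Literature.Probability.LatticeModels.triSitePercolation
Literature.Probability.Percolation.half).real {ω | ¬ (ω ∈
Literature.Probability.Percolation.triLRCrossing n n ↔ (fun x :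
Literature.Probability.LatticeModels.Site 2 => if x 0 / (k n : ℤ) % 2 = 0 then x else x - ![0, (s n
: ℤ)]) ⁻¹' ω ∈ Literature.Probability.Percolation.triLRCrossing n n)}) Filter.atTop (nhds 0))`

## Assembly
Pure bookkeeping, NOT an implication to the summit (barrier route): SeamSlideLaw = (sensitive half)
∧ (insensitive half); the
sensitive half is SeamPivotalMass followed by PivotalSeamForcesFlip (modus ponens on the shared
pivotal-cell event, typed
identically in both items), the insensitive half is SlideInsensitive verbatim. Checked in the
folder's Sketch.lean (`example :
Assembly := by intro h2 h3 h4 hE hS θ hθ k s hks; exact ⟨fun hm => h2 k s hks (h4 hE hS θ hθ k s hks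
hm), fun hm => h3 hE hS θ hθ k s hks hm⟩`, rc 0).

Rationale: WHY THIS LINE. The card's count is elementary once written in the Garban–Pete–Schramm language, but
the printed selective-noise theory stops
exactly short of it: GarbanPeteSchramm2010 Prop 33 (read, pp. 36–37) decides resampling of a
deterministic set U^c only when
r_R ≪ √(R²α₄(R)) (clueless) or |U^c|α₄(R) → 0 (decisive), and BOTH criteria fail for ε²-strips
around an ε-grid at fixed box
scale; its Rem 36 / SmirnovSchramm2011 Rem 4 give the dimensional threshold 5/4 for deterministic
sets, and the seam grid at its
own resolution η = ε² has η^{-3/2} cells — "dimension 3/2 > 5/4" — which is the whole no-go in one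
line. Worse, a patchwork
coupling does not resample the seams, it SLIDES them: a deterministic, local, measure-preserving
rearrangement, the regime that
exclusion sensitivity leaves open (BromanGarbanSteif2012 Thm 1.20 covers n^α-medium-range exclusion
only; nearest-neighbour =
their Conj 9.1 and GarbanVanneuville2019 Conj 1.7; BGS §9.2: "no hope to study the nearest-neighbour
dynamics simply via a
coupling with the i.i.d. dynamics"). So the route imports noise-sensitivity / pivotal-measure
technology (GarbanPeteSchramm2010,
GarbanPeteSchramm2013, SmirnovSchramm2011) into the symmetry-upgrade question of this summit and
asks for one genuinely new
theorem of independent interest (sensitivity under deterministic seam slides), stated over the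
tree's own objects
(`triSitePercolation`, `triLRCrossing`, `fourArm_exponent`, `sepFourArm`, `critFourArmProb`), with
the tractable half resting on the
tree's four-arm/pivotal infrastructure (ArmSeparationFourArm*, FourArmPivotal*, SecondMomentMethod).
What it does that no route or
negative of this summit does: it is the first typed statement constraining HOW an upgrade crux
(CardyRotToConf r2/r3, the
gluing/coupling cards squaring-covariance-cone-graph (b), canonical-gluing-comparison,
zero-error-star-triangle-gluing,
upgrade-witness-mst, square-soup-witness-two-sided-upgrade, white-to-coloured-noise) may be proved,
with a two-sided criterion
rather than a slogan.

RANKED CRUXES. #0 SeamSlideLaw (target) — The 3/4-law for column slides on 𝕋 (both directions),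
conditional on `fourArm_exponent` and four-arm separation: margin n^{3/4}s^{1/4}/k ≥ n^θ ⟹ liminf
P(f_n(ω) ≠ f_n(ω∘slide)) > 0; margin ≤ n^{-θ} ⟹ P(≠) → 0. (why it might fail: Either half can fail
as typed — the sensitive half by flip cancellation (PivotalSeamForcesFlip) or pivotal clumping
(SeamPivotalMass), the insensitive half at the sharp line by seam-defective arms (SlideInsensitive);
it is the slide analogue of the conjectural GPS10 Rem 37 / BGS12 Conj 9.1.) [GarbanPeteSchramm2010,
BromanGarbanSteif2012, SmirnovSchramm2011, SmirnovWernerMRL2001]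
#2 PivotalSeamForcesFlip (crux) — (Structural principle, no exponents.) For ARBITRARY sequences 1 ≤
s_n ≤ k_n ≤ n: if with probability ≥ c > 0 (eventually) some seam site x (k_n ∣ x₀, 0 < x₀ < n) has
an s_n-cell {y : |y-x|_𝕋 ≤ s_n} that is pivotal for the crossing of R(n,n) in ω, then P(f_n(ω) ≠
f_n(ω∘slide)) ≥ c' > 0 eventually. Card items "SeamDecorrelation" (weak form) / the slide analogue
of GPS10 Rem 37. [difficulty: open-problem] (why it might fail: A deterministic measure-preserving
slide is not noise: GPS10 Prop 33 and exclusion sensitivity (BGS12 Thm 1.20 medium-range only; local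
case = BGS12 Conj 9.1, GV19 Conj 1.7, open) do not apply; a cell pivotal for ω need not be pivotal
for ω∘slide (all seams move at once), so flips could cancel.) [GarbanPeteSchramm2010,
BromanGarbanSteif2012, GarbanVanneuville2019, SmirnovSchramm2011]
#3 SlideInsensitive (crux) — (Insensitive side; admissibility of few/short seams.) Assuming
`fourArm_exponent` and four-arm separation: if n^{3/4} s_n^{1/4} ≤ n^{-θ} k_n eventually then
P(f_n(ω) ≠ f_n(ω∘slide)) → 0. Contains: boundedly many seams (k ≥ cn) slid by any s ≤ n^{1-4θ} are
harmless — the slide form of Schramm–Smirnov's discrete gluing along finite-length curves.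
[difficulty: XL] (why it might fail: The sharp line needs four-arm upper bounds for arms with
s-defects at every seam they cross (an arm meets many seams; naive RSW re-gluing at each jump loses
a power n^κ), a universality-type input for a seam-sheared lattice; only a power-lossy threshold is
within gluing technology.) [SmirnovSchramm2011, GarbanPeteSchramm2010, Nolin2008, WernerPCMI2009]
#4 SeamPivotalMass (crux) — (Card lemma "SeamPivotalMass", second-moment form.) Assuming
`fourArm_exponent` (SmirnovWernerMRL2001 Thm 4, j = 4) and four-arm separation (Nolin2008 Thm 11):
if n^{θ} k_n ≤ n^{3/4} s_n^{1/4} eventually then with probability ≥ c > 0 (eventually) some seam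
s_n-cell is pivotal for the crossing of R(n,n). First moment ≍ (n/k)(n/s)α₄(s,n) = margin · n^{o(1)}
→ ∞; second moment ≍ first² (pairs on one seam line contribute 1/margin, pairs on distinct lines
O(1)); Chung–Erdős (tree: SecondMomentMethod). Note P(no pivotal cell) ≥ P(two disjoint crossings) >
c₀, so "→ 1" is false and not claimed. [difficulty: L] (why it might fail: Needs P(s-cell pivotal) ≳
α₄(s,n) in the bulk at inner scale s → ∞ (separation at scale s + RSW corridors to the sides) and a
joint bound P(x,y both pivotal) ≲ α₄(s,d)²α₄(d,n) along one seam line; E N → ∞ alone fails if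
pivotal cells clump along seams (P(N ≥ 1) → 0 while E N ≍ n^θ).) [SmirnovWernerMRL2001, Nolin2008,
WernerPCMI2009, GarbanPeteSchramm2010, GarbanPeteSchramm2013,
Literature.Probability.Percolation.fourArm_exponent,
Literature.Probability.Percolation.Werner2009_pivotal_lowerBound]
#9 ConformalRegimeSensitive (support) — The barrier line proper: in the conformal-patchwork regime
s_n = ⌈k_n²/n⌉ (the seam mismatch forced by SimilarityDefect at box scale ε = k/n), EVERY box scale
√n ≤ k_n ≤ n^{1-θ} is on the sensitive side (margin = (n/k)^{1/2} ≥ n^{θ/2}): P(f_n(ω) ≠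
f_n(ω∘slide)) ≥ c eventually. Follows from PivotalSeamForcesFlip + SeamPivotalMass by arithmetic;
for a model with four-arm exponent ξ the margin is (n/k)^{3-2ξ} · n^{o(1)}, sensitive iff ξ < 3/2
(FK weights near q = 4 have sparser pivotals; percolation fails by 1/4). [difficulty: M]
[GarbanPeteSchramm2010, SmirnovWernerMRL2001, DKKMO2020Rotational]
#9 SimilarityDefect (support) — (Deterministic, provable now; the dictionary patchwork ↦ slide.) For
φ holomorphic near the closed unit square and not affine there, and any M: for m ≥ m₀ and ANY
assignment of complex-affine maps T_{ij}(z) = a_{ij} z + b_{ij} to the m² boxes of side 1/m with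
sup_box |φ - T_{ij}| ≤ M/m², at least c·m² of the interior vertical box edges have endpoint mismatch
max(|T_{ij} - T_{i+1,j}|) ≥ c/m² (hence mismatch ≥ c/(4m²) on a quarter of each such edge: seam
slide ≍ ε² on a positive fraction of the total seam length ε^{-1}). Proof sketch: |a_{ij} -
φ'(z_{ij})| ≤ 4(M + ‖φ''‖/2)/m; where |φ''| ≥ μ > 0, runs of L = O((M + ‖φ''‖)/μ) consecutive boxes
force one slope jump ≥ c₁/m, and an affine mismatch with slope ≥ c₁/m on an edge of length 1/m has
an endpoint value ≥ c₁/(2m²). [difficulty: provable-now] [DKKMO2020Rotational, Beffara2008Universal]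

TWO-LAYER PLAN. Foreseen glued splits (nothing filed now): PivotalSeamForcesFlip ⇐ LocalFlipLemma
(given four well-separated alternating arms at a
seam cell, the slid and unslid inside-connection indicators are distinct increasing functions of the
inside bits and differ with
conditional probability ≥ c) → PivotalCaseSplit (a cell pivotal for ω but not for ω∘slide already
forces disagreement with
conditional probability ≥ c given the outside) → PivotalSeamForcesFlip. SeamPivotalMass ⇐
CellPivotalLowerBound (P ≥ c·α₄(4s, n/8)
for bulk seam cells, from separation at scale s) → JointPivotalUpperBound (one seam line) →
SeamPivotalMass (Chung–Erdős, in tree).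
SlideInsensitive ⇐ OneColumnSlide (union bound over columns via measure preservation: P(≠) ≤
(n/k)·P(≠ for one slid column)) →
TwoSeamDefectiveArms → SlideInsensitive.

KILL CRITERIA. Refutation of PivotalSeamForcesFlip (a slide family with pivotal seam cells w.p. ≥ c
but P(disagree) → 0) closes the route outright
(close --reason refuted:PivotalSeamForcesFlip) — and would itself be remarkable: a rigid seam
transport preserving crossings
despite diverging seam pivotal mass is exactly the coupling the card says cannot exist. Refutation
of ConformalRegimeSensitive
likewise closes the route (the card's claim is false). Refutation of SeamPivotalMass under its
hypotheses would contradict the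
pivotal-measure heuristics of GarbanPeteSchramm2013 — pivot: re-audit the typed margin/cell radius,
restate once. Refutation of
SlideInsensitive only at the sharp line (θ small) ⟹ restate with a power-lossy threshold; the
barrier content (sensitive side)
is unaffected. Mooted (and refuted in spirit) if a box-wise similarity coupling ever proves
conformal covariance of ℤ²
crossings.

NOT DECOMPOSED YET. (i) The ℤ² bond twin: the slide must transport horizontal seam edges with their
left endpoint (a vertex map alone turns seam edges
into non-edges); PivotalSeamForcesFlip transfers verbatim, SeamPivotalMass becomes conditional on
ξ₄(ℤ²) < 3/2, i.e. any bound
α₄(s,n) ≥ (s/n)^{3/2-λ} (known on ℤ²: only 1 < ξ₄ ≤ 2-ε, GPS10 appendix / SS11 Lemma B.1) — filed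
once r2 closes. (ii) Full
decorrelation (asymptotic independence of f_n(ω), f_n(ω∘slide)) versus positive disagreement — the
strong form is not needed for the
barrier. (iii) Patchworks with rotations/dilations inside boxes (non-lattice similarities need
DKKMO's rotation coupling box by
box): covered by the barrier TEXT through SimilarityDefect + the slide law, not by a typed item.
(iv) Constants, cell radii
(s vs 2s vs 4s) and boundary layers of R(n,n) — layer-2 children. (v) Vendoring the landed items as
Literature/Barriers/CriticalPhenomena/SeamPivotalMass (literature seat, after r2/r4 or
ConformalRegimeSensitive land).

CHEAPEST FALSIFIER. Monte-Carlo of the column-slide model on 𝕋 (site percolation p = 1/2, rhombus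
R(n,n), n = 256…2048, 10⁴ samples each):
(a) k = s = ⌊√n⌋ (conformal regime ε = n^{-1/2}, margin n^{1/4}): prediction P(f ≠ f') stays bounded
below (≈ 2p(1-p)-ish, not
→ 0); (b) k = ⌊n^{0.9}⌋, s = 1 (margin n^{-0.15}): prediction P(f ≠ f') → 0; (c) one seam k = ⌊n/2⌋,
s = ⌊n^{0.8}⌋: prediction → 0
slowly ((s/n)^{1/4}); (d) count seam s-cells that are pivotal in (a): prediction mean ≍ n^{1/4}, P(≥
1) bounded below and away
from 1. If (a) tends to 0 or (b) stays bounded below, the typed law is dead. Not run in this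
planning pass (hub compute is async
and the statements do not depend on the outcome's constants); it is the refuter's first check.
Lookup falsifier: any printed
sensitivity theorem for deterministic local rearrangements of critical percolation (none found:
BGS12 §9.3, GV19 Conj 1.7
state the local conservative case as open).

NUMBERS. ξ₄(𝕋) = 5/4 (SmirnovWernerMRL2001 Thm 4, j = 4; tree: `fourArm_exponent`, reduced in
ArmExponentsFourArm*.lean to Smirnov's
scaling limit + separation); pivotal dimension 2 - 5/4 = 3/4; deterministic-set negligibility
threshold dim < 5/4 (GPS10 Rem 36;
SS11 Rem 4) and finite 1-dimensional Minkowski content for discrete gluing (SS11 Thm 1.1); seam grid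
of a scale-ε patchwork at
resolution η = ε²: ε^{-1}/η = η^{-3/2} cells ("dimension 3/2"); E #pivotal seam cells ≍
ε^{-3}(ε²)^{5/4} = ε^{-1/2}; general
four-arm exponent ξ: (n/k)^{3-2ξ}, threshold ξ = 3/2; GPS10 Prop 33 criteria: clueless if r_R ≪
R^{3/8} (fails: r_R ≍ εR),
decisive if |U^c|α₄(R) → 0 (fails: ≍ εR²·R^{-5/4} → ∞); BGS12 conjectured exclusion threshold t_n ≍
n^{-3/4} (Conj 9.1); ℤ²
bounds 1 < ξ₄ ≤ 2 - ε (GV19 p. 6 citing GPS10 appendix and SS11 Lemma B.1).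

DEFINITION REQUESTS. Two notions are inlined in every item and would shorten the route file if filed
under Literature/Probability/Percolation:
`IsPivotalCell A x s ω := ∃ ω', (∀ y, s < triNorm (y - x) → (y ∈ ω' ↔ y ∈ ω)) ∧ ¬ (ω' ∈ A ↔ ω ∈ A)`
(cell version of the tree's
`IsPivotal`, GPS10 §2 "r-pivotal") and `columnSlide k s : Site 2 → Site 2 := fun x => if x 0 / k % 2
= 0 then x else x - ![0, s]`
(requested after open with `ledger workitem add --kind definition`). No cite facts are requested:
`fourArm_exponent` exists as a named
fact and the separation input is carried in the binder shape of ArmSeparationFourArmProofs.lean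
(D-0026).

Novelty: Searches (2026-08-15): lit read arXiv:0803.3750 (GPS10 Prop 33 + Rem 34–37, pp. 36–37: both criteria
fail for seam strips at fixed
box scale; Rem 37 pivotal criterion conjectural); lit read arXiv:1101.1865 (BGS12: Thm 1.19–1.20
complete-graph and n^α
medium-range exclusion sensitivity; §9.2 "no hope to study the nearest-neighbor dynamics simply via
a coupling with the i.i.d.
dynamics"; Conj 9.1); lit read arXiv:1605.04766 (GV19 p. 1 "the case of a nearest-neighbour simple
exclusion process … is left
widely open", Conj 1.7); lit read arXiv:1101.5820 (SS11 Thm 1.1 discrete gluing under finite 1-dim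
Minkowski content; Rem 4
dimension threshold 5/4; Rem 5 two-sided touching 2/3 + 2/3 - 1 = 1/3); lit search --hybrid "noise
sensitivity percolation crossing
deterministic set selective noise" (10 book rows: Kesten 1982, Lyons–Peres 2016, Grimmett 1999,
Bollobás–Riordan 2006 …, nothing
closer); lit search --source zbmath "exclusion sensitivity percolation" (5 rows: arXiv:1102.5761
Garban–Steif notes,
BromanGarbanSteif2012, GarbanVanneuville2019, Forsström EJP 2016 monotonicity of exclusion
sensitivity, ICM 2010 vol.); lit frontier
CriticalPhenomena --since 2020 (30 rows, none on upgrade no-gos or rearrangement sensitivity);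
ledger negatives (1 row, SAW,
unrelated); barrier catalogue (ScaleCovarianceNotMoebius the only symmetry-upgrade entry, 3-D Ising,
qualitative); lean search (no
noise-sensitivity / spectral-sample / Schramm–Smirnov gluing declarations in Literature).
OpenAlex/S2/ar  [refs: 0803.3750, 1101.1865, 1605.04766, 1101.5820, 1102.5761, BromanGarbanSteif2012, GarbanVanneuville2019, GarbanPeteSchramm2010, SmirnovSchramm2011]

Barriers (technique_class: symmetry-upgrade, patchwork-coupling, noise-sensitivity): - technique_class: symmetry-upgrade, patchwork-similarity-coupling, noise-sensitivity
- Literature.Barriers.CriticalPhenomena.ScaleCovarianceNotMoebius: consistent with it, not blocked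
by it — that entry (technique_class scale-implies-conformal, symmetry-upgrade) shows Euclidean +
scale data alone cannot force Möbius covariance (3-D Ising correlation families, qualitative
witness); this route is its planar-percolation, coupling-level cousin: even with the full lattice
model and every similarity symmetry in hand, TWO-dimensional patchworks fail quantitatively (ξ₄ =
5/4 < 3/2), and it names what the entry's scope caveat (a) permits — model-specific 0/1-dimensional
Markov/exploration structure (Schramm's principle, exit laws).
- Literature.Barriers.CriticalPhenomena.EmbeddingModulusUniqueness: bites any eventual USE of an
upgrade for CardyFormulaZ2, not this no-go; the route is embedding-aware (it consumes ξ₄ = 5/4 on 𝕋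
and states the ℤ² twin only conditionally) and claims no conformal invariance; complementary:
Beffara's barrier kills embedding-blind arguments, this one a class of embedding-aware but
two-dimensional-seam couplings.
- Literature.Barriers.CriticalPhenomena.SmirnovTriangularOnly: not applicable — no
discrete-holomorphic observable, no colour switching.
- Literature.Barriers.CriticalPhenomena.FKParafermionicHalfCauchyRiemann: not applicable — no
parafermionic observable or discrete boundary-value problem.
- Literature.Barriers.CriticalPhenomena.CoveringLatticeShift

History (route lifecycle, newest last):
- 2026-08-15T13:48:10Z · CLOSED retired — not-a-thesis: assembly does not conclude the sub-problem Statement (operator:999:1257524)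

sub-problem: CardyFormulaZ2 · status: closed(retired) · opened planner-plancard-CriticalPhenomena-CardyFormu-1fa653fe-0 2026-08-15T11:34:59Z · rev 0 · ledger route-CriticalPhenomena-SeamPivotalNoGo
GENERATED by the gate from the ledger (D-0016/17). Provers cite these decls: `theorem foo : Summit.CriticalPhenomena.CardyFormulaZ2.Theses.SeamPivotalNoGo.<Decl> := …` in Summits/CriticalPhenomena/CardyFormulaZ2/Theorems/<Name>.lean.
-/

namespace Summit.CriticalPhenomena.CardyFormulaZ2.Theses.SeamPivotalNoGo

open scoped BigOperators Topology Manifold Classical MeasureTheory ProbabilityTheory Matrix InnerProductSpace ComplexConjugate ContinuousMap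
open Filter Set Function TopologicalSpace MeasureTheory

attribute [summit_statement] _root_.CardyFormulaZ2

/-- item stmt-CriticalPhenomena-4753 · target · rank 0 · closed · moot by None · by planner
why it might fail: Either half can fail as typed — the sensitive half by flip cancellation (PivotalSeamForcesFlip) or pivotal clumping (SeamPivotalMass), the insensitive half at the sharp line by seam-defective arms (SlideInsensitive); it is the slide analogue of the conjectural GPS10 Rem 37 / BGS12 Conj 9.1.
sources: GarbanPeteSchramm2010, BromanGarbanSteif2012, SmirnovSchramm2011, SmirnovWernerMRL2001
[target] The 3/4-law for column slides on 𝕋 (both directions), conditional on `fourArm_exponent` and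
four-arm separation: margin n^{3/4}s^{1/4}/k ≥ n^θ ⟹ liminf P(f_n(ω) ≠ f_n(ω∘slide)) > 0; margin ≤
n^{-θ} ⟹ P(≠) → 0. -/
@[route_item "route-CriticalPhenomena-SeamPivotalNoGo"]
def SeamSlideLaw : Prop :=
  Literature.Probability.Percolation.fourArm_exponent → (∃ c : ℝ, 0 < c ∧ ∃ n₀ : ℕ, ∀ n N : ℕ, n₀ ≤ n → 2 * n ≤ N → c * Literature.Probability.Percolation.critFourArmProb n N ≤ (Literature.Probability.LatticeModels.triSitePercolation Literature.Probability.Percolation.half).real (Literature.Probability.Percolation.sepFourArm n N)) → ∀ θ : ℝ, 0 < θ → ∀ k s : ℕ → ℕ, (∀ n, 1 ≤ n → 1 ≤ s n ∧ s n ≤ k n ∧ k n ≤ n) → ((∀ᶠ n : ℕ in Filter.atTop, (n : ℝ) ^ θ * (k n : ℝ) ≤ (n : ℝ) ^ (3 / 4 : ℝ) * (s n : ℝ) ^ (1 / 4 : ℝ)) → ∃ c : ℝ, 0 < c ∧ ∀ᶠ n : ℕ in Filter.atTop, c ≤ (Literature.Probability.LatticeModels.triSitePercolation Literature.Probability.Percolation.half).real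 {ω | ¬ (ω ∈ Literature.Probability.Percolation.triLRCrossing n n ↔ (fun x : Literature.Probability.LatticeModels.Site 2 => if x 0 / (k n : ℤ) % 2 = 0 then x else x - ![0, (s n : ℤ)]) ⁻¹' ω ∈ Literature.Probability.Percolation.triLRCrossing n n)}) ∧ ((∀ᶠ n : ℕ in Filter.atTop, (n : ℝ) ^ (3 / 4 : ℝ) * (s n : ℝ) ^ (1 / 4 : ℝ) ≤ (n : ℝ) ^ (-θ) * (k n : ℝ)) → Filter.Tendsto (fun n : ℕ => (Literature.Probability.LatticeModels.triSitePercolation Literature.Probability.Percolation.half).real {ω | ¬ (ω ∈ Literature.Probability.Percolation.triLRCrossing n n ↔ (fun x : Literature.Probability.LatticeModels.Site 2 => if x 0 / (k n : ℤ) % 2 = 0 then x else x - ![0, (s n : ℤ)]) ⁻¹' ω ∈ Literature.Probability.Percolation.triLRCrossing n n)}) Filter.atTop (nhds 0))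

/-- item stmt-CriticalPhenomena-4754 · crux · rank 2 · closed · moot by None · by planner
why it might fail: A deterministic measure-preserving slide is not noise: GPS10 Prop 33 and exclusion sensitivity (BGS12 Thm 1.20 medium-range only; local case = BGS12 Conj 9.1, GV19 Conj 1.7, open) do not apply; a cell pivotal for ω need not be pivotal for ω∘slide (all seams move at once), so flips could cancel.
sources: GarbanPeteSchramm2010, BromanGarbanSteif2012, GarbanVanneuville2019, SmirnovSchramm2011
[crux] (Structural principle, no exponents.) For ARBITRARY sequences 1 ≤ s_n ≤ k_n ≤ n: if with
probability ≥ c > 0 (eventually) some seam site x (k_n ∣ x₀, 0 < x₀ < n) has an s_n-cell {y :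
|y-x|_𝕋 ≤ s_n} that is pivotal for the crossing of R(n,n) in ω, then P(f_n(ω) ≠ f_n(ω∘slide)) ≥ c' >
0 eventually. Card items "SeamDecorrelation" (weak form) / the slide analogue of GPS10 Rem 37.
[difficulty: open-problem] -/
@[route_item "route-CriticalPhenomena-SeamPivotalNoGo"]
def PivotalSeamForcesFlip : Prop :=
  ∀ k s : ℕ → ℕ, (∀ n, 1 ≤ n → 1 ≤ s n ∧ s n ≤ k n ∧ k n ≤ n) → (∃ c : ℝ, 0 < c ∧ ∀ᶠ n : ℕ in Filter.atTop, c ≤ (Literature.Probability.LatticeModels.triSitePercolation Literature.Probability.Percolation.half).real {ω | ∃ x ∈ Literature.Probability.Percolation.rectangle n n, ((k n : ℤ) ∣ x 0 ∧ 0 < x 0 ∧ x 0 < (n : ℤ)) ∧ ∃ ω' : Literature.Probability.Percolation.SiteConfig (Literature.Probability.LatticeModels.Site 2), (∀ y, (s n : ℤ) < Literature.Probability.LatticeModels.triNorm (y - x) → (y ∈ ω' ↔ y ∈ ω)) ∧ ¬ (ω' ∈ Literature.Probability.Percolation.triLRCrossing n n ↔ ω ∈ Literature.Probability.Percolation.triLRCrossing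 n n)}) → ∃ c : ℝ, 0 < c ∧ ∀ᶠ n : ℕ in Filter.atTop, c ≤ (Literature.Probability.LatticeModels.triSitePercolation Literature.Probability.Percolation.half).real {ω | ¬ (ω ∈ Literature.Probability.Percolation.triLRCrossing n n ↔ (fun x : Literature.Probability.LatticeModels.Site 2 => if x 0 / (k n : ℤ) % 2 = 0 then x else x - ![0, (s n : ℤ)]) ⁻¹' ω ∈ Literature.Probability.Percolation.triLRCrossing n n)}

/-- item stmt-CriticalPhenomena-4755 · crux · rank 3 · closed · moot by None · by planner
why it might fail: The sharp line needs four-arm upper bounds for arms with s-defects at every seam they cross (an arm meets many seams; naive RSW re-gluing at each jump loses a power n^κ), a universality-type input for a seam-sheared lattice; only a power-lossy threshold is within gluing technology.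
sources: SmirnovSchramm2011, GarbanPeteSchramm2010, Nolin2008, WernerPCMI2009
[crux] (Insensitive side; admissibility of few/short seams.) Assuming `fourArm_exponent` and
four-arm separation: if n^{3/4} s_n^{1/4} ≤ n^{-θ} k_n eventually then P(f_n(ω) ≠ f_n(ω∘slide)) → 0.
Contains: boundedly many seams (k ≥ cn) slid by any s ≤ n^{1-4θ} are harmless — the slide form of
Schramm–Smirnov's discrete gluing along finite-length curves. [difficulty: XL] -/
@[route_item "route-CriticalPhenomena-SeamPivotalNoGo"]
def SlideInsensitive : Prop :=
  Literature.Probability.Percolation.fourArm_exponent → (∃ c : ℝ, 0 < c ∧ ∃ n₀ : ℕ, ∀ n N : ℕ, n₀ ≤ n → 2 * n ≤ N → c * Literature.Probability.Percolation.critFourArmProb n N ≤ (Literature.Probability.LatticeModels.triSitePercolation Literature.Probability.Percolation.half).real (Literature.Probability.Percolation.sepFourArm n N)) → ∀ θ : ℝ, 0 < θ → ∀ k s : ℕ → ℕ, (∀ n, 1 ≤ n → 1 ≤ s n ∧ s n ≤ k n ∧ k n ≤ n) → (∀ᶠ n : ℕ in Filter.atTop, (n : ℝ) ^ (3 / 4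 : ℝ) * (s n : ℝ) ^ (1 / 4 : ℝ) ≤ (n : ℝ) ^ (-θ) * (k n : ℝ)) → Filter.Tendsto (fun n : ℕ => (Literature.Probability.LatticeModels.triSitePercolation Literature.Probability.Percolation.half).real {ω | ¬ (ω ∈ Literature.Probability.Percolation.triLRCrossing n n ↔ (fun x : Literature.Probability.LatticeModels.Site 2 => if x 0 / (k n : ℤ) % 2 = 0 then x else x - ![0, (s n : ℤ)]) ⁻¹' ω ∈ Literature.Probability.Percolation.triLRCrossing n n)}) Filter.atTop (nhds 0)

/-- item stmt-CriticalPhenomena-4756 · crux · rank 4 · closed · moot by None · by planner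
why it might fail: Needs P(s-cell pivotal) ≳ α₄(s,n) in the bulk at inner scale s → ∞ (separation at scale s + RSW corridors to the sides) and a joint bound P(x,y both pivotal) ≲ α₄(s,d)²α₄(d,n) along one seam line; E N → ∞ alone fails if pivotal cells clump along seams (P(N ≥ 1) → 0 while E N ≍ n^θ).
sources: SmirnovWernerMRL2001, Nolin2008, WernerPCMI2009, GarbanPeteSchramm2010, GarbanPeteSchramm2013
[crux] (Card lemma "SeamPivotalMass", second-moment form.) Assuming `fourArm_exponent`
(SmirnovWernerMRL2001 Thm 4, j = 4) and four-arm separation (Nolin2008 Thm 11): if n^{θ} k_n ≤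
n^{3/4} s_n^{1/4} eventually then with probability ≥ c > 0 (eventually) some seam s_n-cell is
pivotal for the crossing of R(n,n). First moment ≍ (n/k)(n/s)α₄(s,n) = margin · n^{o(1)} → ∞; second
moment ≍ first² (pairs on one seam line contribute 1/margin, pairs on distinct lines O(1));
Chung–Erdős (tree: SecondMomentMethod). Note P(no pivotal cell) ≥ P(two disjoint crossings) > c₀, so
"→ 1" is false and not claimed. [difficulty: L] -/
@[route_item "route-CriticalPhenomena-SeamPivotalNoGo"]
def SeamPivotalMass : Prop :=
  Literature.Probability.Percolation.fourArm_exponent → (∃ c : ℝ, 0 < c ∧ ∃ n₀ : ℕ, ∀ n N : ℕ, n₀ ≤ n → 2 * n ≤ N → c * Literature.Probability.Percolation.critFourArmProb n N ≤ (Literature.Probability.LatticeModels.triSitePercolation Literature.Probability.Percolation.half).real (Literature.Probability.Percolation.sepFourArm n N)) → ∀ θ : ℝ, 0 < θ → ∀ k s : ℕ → ℕ, (∀ n, 1 ≤ n → 1 ≤ s n ∧ s n ≤ k n ∧ k n ≤ n) → (∀ᶠ n : ℕ in Filter.atTop, (n : ℝ) ^ θ * (k n : ℝ) ≤ (n : ℝ)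 ^ (3 / 4 : ℝ) * (s n : ℝ) ^ (1 / 4 : ℝ)) → ∃ c : ℝ, 0 < c ∧ ∀ᶠ n : ℕ in Filter.atTop, c ≤ (Literature.Probability.LatticeModels.triSitePercolation Literature.Probability.Percolation.half).real {ω | ∃ x ∈ Literature.Probability.Percolation.rectangle n n, ((k n : ℤ) ∣ x 0 ∧ 0 < x 0 ∧ x 0 < (n : ℤ)) ∧ ∃ ω' : Literature.Probability.Percolation.SiteConfig (Literature.Probability.LatticeModels.Site 2), (∀ y, (s n : ℤ) < Literature.Probability.LatticeModels.triNorm (y - x) → (y ∈ ω' ↔ y ∈ ω)) ∧ ¬ (ω' ∈ Literature.Probability.Percolation.triLRCrossing n n ↔ ω ∈ Literature.Probability.Percolation.triLRCrossing n n)}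

/-- item stmt-CriticalPhenomena-4757 · support · rank 9 · closed · moot by None · by planner
sources: GarbanPeteSchramm2010, SmirnovWernerMRL2001, DKKMO2020Rotational
[support] The barrier line proper: in the conformal-patchwork regime s_n = ⌈k_n²/n⌉ (the seam
mismatch forced by SimilarityDefect at box scale ε = k/n), EVERY box scale √n ≤ k_n ≤ n^{1-θ} is on
the sensitive side (margin = (n/k)^{1/2} ≥ n^{θ/2}): P(f_n(ω) ≠ f_n(ω∘slide)) ≥ c eventually.
Follows from PivotalSeamForcesFlip + SeamPivotalMass by arithmetic; for a model with four-arm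
exponent ξ the margin is (n/k)^{3-2ξ} · n^{o(1)}, sensitive iff ξ < 3/2 (FK weights near q = 4 have
sparser pivotals; percolation fails by 1/4). [difficulty: M] -/
@[route_item "route-CriticalPhenomena-SeamPivotalNoGo"]
def ConformalRegimeSensitive : Prop :=
  Literature.Probability.Percolation.fourArm_exponent → (∃ c : ℝ, 0 < c ∧ ∃ n₀ : ℕ, ∀ n N : ℕ, n₀ ≤ n → 2 * n ≤ N → c * Literature.Probability.Percolation.critFourArmProb n N ≤ (Literature.Probability.LatticeModels.triSitePercolation Literature.Probability.Percolation.half).real (Literature.Probability.Percolation.sepFourArm n N)) → ∀ θ : ℝ, 0 < θ → ∀ k : ℕ → ℕ, (∀ n, 1 ≤ n → 1 ≤ k n ∧ k n ≤ n) → (∀ᶠ n : ℕ in Filter.atTop, Real.sqrt n ≤ (k n : ℝ) ∧ (k n : ℝ) ≤ (n : ℝ) ^ (1 - θ)) → ∃ c : ℝ, 0 < c ∧ ∀ᶠ n : ℕ in Filter.atTop, c ≤ (Literature.Probability.LatticeModels.triSitePercolation Literature.Probability.Percolation.half).real {ω | ¬ (ω ∈ Literature.Probability.Percolation.triLRCrossing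 n n ↔ (fun x : Literature.Probability.LatticeModels.Site 2 => if x 0 / (k n : ℤ) % 2 = 0 then x else x - ![0, ((⌈((k n : ℝ) ^ 2) / (n : ℝ)⌉₊ : ℕ) : ℤ)]) ⁻¹' ω ∈ Literature.Probability.Percolation.triLRCrossing n n)}

/-- item stmt-CriticalPhenomena-4758 · support · rank 9 · closed · moot by None · by planner
sources: DKKMO2020Rotational, Beffara2008Universal
[support] (Deterministic, provable now; the dictionary patchwork ↦ slide.) For φ holomorphic near
the closed unit square and not affine there, and any M: for m ≥ m₀ and ANY assignment of
complex-affine maps T_{ij}(z) = a_{ij} z + b_{ij} to the m² boxes of side 1/m with sup_box |φ -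
T_{ij}| ≤ M/m², at least c·m² of the interior vertical box edges have endpoint mismatch max(|T_{ij}
- T_{i+1,j}|) ≥ c/m² (hence mismatch ≥ c/(4m²) on a quarter of each such edge: seam slide ≍ ε² on a
positive fraction of the total seam length ε^{-1}). Proof sketch: |a_{ij} - φ'(z_{ij})| ≤ 4(M +
‖φ''‖/2)/m; where |φ''| ≥ μ > 0, runs of L = O((M + ‖φ''‖)/μ) consecutive boxes force one slope jump
≥ c₁/m, and an affine mismatch with slope ≥ c₁/m on an edge of length 1/m has an endpoint value ≥
c₁/(2m²). [difficulty: provable-now] -/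
@[route_item "route-CriticalPhenomena-SeamPivotalNoGo"]
def SimilarityDefect : Prop :=
  ∀ (φ : ℂ → ℂ) (U : Set ℂ) (M : ℝ), IsOpen U → (Set.Icc (0 : ℝ) 1 ×ℂ Set.Icc (0 : ℝ) 1) ⊆ U → DifferentiableOn ℂ φ U → (¬ ∃ a b : ℂ, ∀ z ∈ (Set.Icc (0 : ℝ) 1 ×ℂ Set.Icc (0 : ℝ) 1), φ z = a * z + b) → ∃ c : ℝ, 0 < c ∧ ∃ m₀ : ℕ, ∀ m : ℕ, m₀ ≤ m → ∀ a b : ℕ → ℕ → ℂ, (∀ i j : ℕ, i < m → j < m → ∀ z : ℂ, z.re ∈ Set.Icc ((i : ℝ) / m) ((i + 1 : ℝ) / m) → z.im ∈ Set.Icc ((j : ℝ) / m) ((j + 1 : ℝ) / m) → ‖φ z - (a i j * z + b i j)‖ ≤ M / (m : ℝ) ^ 2) → c * (m : ℝ) ^ 2 ≤ (((Finset.range (m - 1) ×ˢ Finset.range m).filter (fun p : ℕ × ℕ => c / (m : ℝ) ^ 2 ≤ max ‖(a p.1 p.2 - a (p.1 + 1) p.2) * ((((p.1 + 1 : ℕ)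 : ℝ) / m : ℝ) + (((p.2 : ℝ) / m : ℝ)) * Complex.I) + (b p.1 p.2 - b (p.1 + 1) p.2)‖ ‖(a p.1 p.2 - a (p.1 + 1) p.2) * ((((p.1 + 1 : ℕ) : ℝ) / m : ℝ) + ((((p.2 + 1 : ℕ) : ℝ) / m : ℝ)) * Complex.I) + (b p.1 p.2 - b (p.1 + 1) p.2)‖)).card : ℝ)

/-- item stmt-CriticalPhenomena-4759 · assembly · rank 1 · closed · moot by None · by planner
sources: GarbanPeteSchramm2010, SmirnovSchramm2011
[assembly] PivotalSeamForcesFlip → SlideInsensitive → SeamPivotalMass → SeamSlideLaw -/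
@[route_item "route-CriticalPhenomena-SeamPivotalNoGo"]
def Assembly : Prop :=
  PivotalSeamForcesFlip → SlideInsensitive → SeamPivotalMass → SeamSlideLaw

end Summit.CriticalPhenomena.CardyFormulaZ2.Theses.SeamPivotalNoGo
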